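import Literature.Topology.FourManifolds.CuspSplittingChart
import Literature.Topology.FourManifolds.OneJetTransverseTarget
import Literature.Topology.FourManifolds.OneJetGenericMapsExist
import Literature.Topology.FourManifolds.RankOneNormalForm
import HarnessLib

/-!
# Every transverse cusp candidate of a map `ℝ⁴ → ℝ²` has a cusp-splitting chart

Topic `Literature/Topology/FourManifolds` (programme of the fact
`Literature.Topology.FourManifolds.exists_isSimplifiedBrokenLefschetzFibration`, Baykur–Saeki 2017, §2.1).
Synthesis of the cusp-splitting line: at a point `p` of a `C^∞` map `F : ℝ⁴ → ℝ²` with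
`dF_p ≠ 0` which is a cusp candidate (`OneJet.IsCuspCandidateAt`, Golubitsky–Guillemin VI
(2.1)(b)) and at which `j¹F ⋔ S₁` (`OneJet.IsOneJetTransverseAt`), there are centred smooth
charts in which `F = (t, h(t, x) + ε₂ y² + ε₃ z²)` (`HasCuspSplitChart F p`,
`CuspSplittingChart.lean`) — the reduction of the four-dimensional cusp to Whitney's planar
situation `(x₁, h(x₁, x₂))` (GG VI §2, (†) p. 147).

Steps: rank-one charts (`RankOneNormalForm.exists_rankOne_charts`), cut-off globalisation of
the fibre function, transport of the two conditions to the rank-one representative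
(`isCuspCandidateAt_comp_iff` / `_comp_target_iff`, `isOneJetTransverseAt_comp_iff` /
`_comp_target_iff`) and their reading on `f` (`RankOneMapJets.lean`), a linear shear of `ℝ⁴`
preserving the coordinate `y₀` which puts the radical of the fibre Hessian on the `y₁`-axis
(`exists_shear`; transversality forces the radical to be a line, so the `(y₂, y₃)`-block becomes
nondegenerate), `hasCuspSplitChart_rankOneMap`, and transport back
(`HasCuspSplitChart.of_localRepresentative`, `HasCuspSplitChart.congr_of_eventuallyEq`).

Everything is proved; no definitions besides those of the imported files; no named fact (D-0026).

## References

* M. Golubitsky, V. Guillemin, *Stable Mappings and Their Singularities*, GTM 14 (1973), Ch. VI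
  §2, (2.1), (†) p. 147 and proof of Thm. 2.4. [GolubitskyGuillemin1973]
* R. İ. Baykur, O. Saeki, *Simplifying indefinite fibrations on 4-manifolds*, arXiv:1705.11169,
  §2.1, p. 6. [BaykurSaeki2017]
-/

noncomputable section

set_option maxSynthPendingDepth 2

open Set Function Filter Module
open scoped ContDiff Topology

namespace Literature.Topology.FourManifolds

/-- Local notation: `𝔼 n` is the model Euclidean space `EuclideanSpace ℝ (Fin n)`. -/
local notation "𝔼 " n:arg => EuclideanSpace ℝ (Fin n)

/-- Local notation: the coordinate covectors of `ℝ⁴`. -/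
local notation "π₄" => (EuclideanSpace.proj (𝕜 := ℝ) (ι := Fin 4))

/-! ### Locality and invariance of the chart condition -/

/-- **The chart condition is local.** [folklore] -/
theorem HasCuspSplitChart.congr_of_eventuallyEq {F₁ F₂ : 𝔼 4 → 𝔼 2} {y : 𝔼 4}
    (h : HasCuspSplitChart F₁ y) (heq : F₁ =ᶠ[𝓝 y] F₂) : HasCuspSplitChart F₂ y := by
  obtain ⟨φ, ψ, hh, U, ε₂, ε₃, hy, hy0, hmaps, hφ, hφs, hψ, hψs, hU, hhs, hφU, hh0, hε₂, hε₃,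
    hid⟩ := h
  obtain ⟨S, hSsub, hSo, hyS⟩ : ∃ S ⊆ {q | F₁ q = F₂ q}, IsOpen S ∧ y ∈ S :=
    _root_.mem_nhds_iff.1 heq
  have hsrc : (φ.restrOpen S hSo).source = φ.source ∩ S :=
    OpenPartialHomeomorph.restrOpen_source φ S hSo
  have htgt : (φ.restrOpen S hSo).target ⊆ φ.target := by
    intro z hz
    have h1 : (φ.restrOpen S hSo).symm z ∈ (φ.restrOpen S hSo).source :=
      (φ.restrOpen S hSo).map_target hz
    have h2 : (φ.restrOpen S hSo) ((φ.restrOpen S hSo).symm z) = z :=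
      (φ.restrOpen S hSo).right_inv hz
    rw [hsrc] at h1
    have h3 : φ (φ.symm z) = z := h2
    rw [← h3]
    exact φ.map_source h1.1
  refine ⟨φ.restrOpen S hSo, ψ, hh, U, ε₂, ε₃, ?_, hy0, ?_, ?_, hφs.mono htgt, hψ, hψs, hU, hhs,
    ?_, hh0, hε₂, hε₃, ?_⟩
  · rw [hsrc]
    exact ⟨hy, hyS⟩
  · intro q hq
    rw [hsrc] at hq
    rw [← show F₁ q = F₂ q from hSsub hq.2]
    exact hmaps hq.1
  · rw [hsrc]
    exact hφ.mono inter_subset_left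
  · intro q hq
    rw [hsrc] at hq
    exact hφU q hq.1
  · intro q hq
    rw [hsrc] at hq
    rw [← show F₁ q = F₂ q from hSsub hq.2]
    exact hid q hq.1

/-- **The chart condition is invariant under smooth local coordinate changes**: if the local
representative `Ψ₀ ∘ F ∘ Φ₀⁻¹` has a cusp-splitting chart at `Φ₀ p`, so has `F` at `p`
(compose the charts). [folklore] -/
theorem HasCuspSplitChart.of_localRepresentative {F : 𝔼 4 → 𝔼 2} {p : 𝔼 4}
    {Φ₀ : OpenPartialHomeomorph (𝔼 4) (𝔼 4)} {Ψ₀ : OpenPartialHomeomorph (𝔼 2) (𝔼 2)}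
    (hΦ₀ : ContDiffOn ℝ ∞ Φ₀ Φ₀.source) (hΦ₀s : ContDiffOn ℝ ∞ Φ₀.symm Φ₀.target)
    (hΨ₀ : ContDiffOn ℝ ∞ Ψ₀ Ψ₀.source) (hΨ₀s : ContDiffOn ℝ ∞ Ψ₀.symm Ψ₀.target)
    (hmaps : MapsTo F Φ₀.source Ψ₀.source) (hp : p ∈ Φ₀.source)
    (h : HasCuspSplitChart (Ψ₀ ∘ F ∘ Φ₀.symm) (Φ₀ p)) : HasCuspSplitChart F p := by
  obtain ⟨φm, ψm, hh, U, ε₂, ε₃, hpm, hpm0, hmapsm, hφm, hφms, hψm, hψms, hU, hhs, hφU, hh0, hε₂,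
    hε₃, hid⟩ := h
  have hFq : ∀ q ∈ Φ₀.source, (Ψ₀ ∘ F ∘ Φ₀.symm) (Φ₀ q) = Ψ₀ (F q) := fun q hq => by
    simp only [Function.comp_apply, Φ₀.left_inv hq]
  refine ⟨Φ₀.trans φm, Ψ₀.trans ψm, hh, U, ε₂, ε₃, ?_, ?_, ?_, ?_, ?_, ?_, ?_, hU, hhs, ?_, hh0,
    hε₂, hε₃, ?_⟩
  · rw [OpenPartialHomeomorph.trans_source]
    exact ⟨hp, hpm⟩
  · rw [OpenPartialHomeomorph.coe_trans, Function.comp_apply, hpm0]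
  · intro q hq
    rw [OpenPartialHomeomorph.trans_source] at hq ⊢
    refine ⟨hmaps hq.1, ?_⟩
    show Ψ₀ (F q) ∈ ψm.source
    rw [← hFq q hq.1]
    exact hmapsm hq.2
  · rw [OpenPartialHomeomorph.trans_source, OpenPartialHomeomorph.coe_trans]
    exact hφm.comp (hΦ₀.mono inter_subset_left) fun q hq => hq.2
  · rw [OpenPartialHomeomorph.trans_symm_eq_symm_trans_symm, OpenPartialHomeomorph.trans_target,
      OpenPartialHomeomorph.coe_trans]
    exact hΦ₀s.comp (hφms.mono inter_subset_left) fun y hy => hy.2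
  · rw [OpenPartialHomeomorph.trans_source, OpenPartialHomeomorph.coe_trans]
    exact hψm.comp (hΨ₀.mono inter_subset_left) fun q hq => hq.2
  · rw [OpenPartialHomeomorph.trans_symm_eq_symm_trans_symm, OpenPartialHomeomorph.trans_target,
      OpenPartialHomeomorph.coe_trans]
    exact hΨ₀s.comp (hψms.mono inter_subset_left) fun y hy => hy.2
  · intro q hq
    rw [OpenPartialHomeomorph.trans_source] at hq
    simp only [OpenPartialHomeomorph.coe_trans, Function.comp_apply]
    exact hφU (Φ₀ q) hq.2
  · intro q hq
    rw [OpenPartialHomeomorph.trans_source] at hq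
    simp only [OpenPartialHomeomorph.coe_trans, Function.comp_apply]
    have h := hid (Φ₀ q) hq.2
    rw [hFq q hq.1] at h
    exact h

/-- The chart condition transported through a linear automorphism of the source. [folklore] -/
theorem HasCuspSplitChart.of_comp_continuousLinearEquiv {F : 𝔼 4 → 𝔼 2} {p : 𝔼 4}
    (T : 𝔼 4 ≃L[ℝ] 𝔼 4) (h : HasCuspSplitChart (F ∘ T.symm) (T p)) : HasCuspSplitChart F p := by
  set Φ₀ : OpenPartialHomeomorph (𝔼 4) (𝔼 4) := T.toHomeomorph.toOpenPartialHomeomorph with hΦ₀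
  have hΦ₀a : (Φ₀ : 𝔼 4 → 𝔼 4) = T := rfl
  have hΦ₀sa : (Φ₀.symm : 𝔼 4 → 𝔼 4) = T.symm := rfl
  refine HasCuspSplitChart.of_localRepresentative (Φ₀ := Φ₀) (Ψ₀ := OpenPartialHomeomorph.refl (𝔼 2))
    ?_ ?_ contDiffOn_id contDiffOn_id (fun q _ => mem_univ _) (by simp [hΦ₀]) ?_
  · rw [hΦ₀a]
    exact T.contDiff.contDiffOn
  · rw [hΦ₀sa]
    exact T.symm.contDiff.contDiffOn
  · rw [hΦ₀sa, hΦ₀a]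
    exact h

/-! ### The normalising shear -/

/-- **A linear automorphism of `ℝ⁴` preserving the coordinate `y₀` and sending a given non-zero
fibre vector `k₀` (`k₀₀ = 0`) to `e₁`** (a shear `id + (k₀ - e_j) ⊗ e_j*` followed by the
transposition of the coordinates `1` and `j`, `k₀ⱼ ≠ 0`). [folklore] -/
theorem exists_shear {k₀ : 𝔼 4} (hk₀ : k₀ ≠ 0) (hk₀0 : k₀ 0 = 0) :
    ∃ T : 𝔼 4 ≃L[ℝ] 𝔼 4, (∀ y : 𝔼 4, T y 0 = y 0) ∧
      T k₀ = EuclideanSpace.single (1 : Fin 4) (1 : ℝ) := by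
  -- a coordinate `j ≠ 0` with `k₀ j ≠ 0`
  obtain ⟨j, hj0, hj⟩ : ∃ j : Fin 4, j ≠ 0 ∧ k₀ j ≠ 0 := by
    by_contra hcon
    push Not at hcon
    apply hk₀
    ext i
    by_cases hi : i = 0
    · rw [hi]
      simpa using hk₀0
    · simpa using hcon i hi
  set ej : 𝔼 4 := EuclideanSpace.single j (1 : ℝ) with hej
  set u : 𝔼 4 := k₀ - ej with hu
  -- the shear `R = id + u ⊗ e_j*` and its inverse
  set R₁ : 𝔼 4 →L[ℝ] 𝔼 4 := ContinuousLinearMap.id ℝ (𝔼 4) + (π₄ j).smulRight u with hR₁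
  set R₂ : 𝔼 4 →L[ℝ] 𝔼 4 :=
    ContinuousLinearMap.id ℝ (𝔼 4) - (k₀ j)⁻¹ • (π₄ j).smulRight u with hR₂
  have huj : u j = k₀ j - 1 := by simp [hu, hej]
  have h12 : ∀ y, R₁ (R₂ y) = y := fun y => by
    simp only [hR₁, hR₂, _root_.add_apply, ContinuousLinearMap.id_apply, _root_.sub_apply,
      _root_.smul_apply, ContinuousLinearMap.smulRight_apply, map_sub, map_smul]
    simp only [show ∀ z : 𝔼 4, (π₄ j) z = z j from fun z => rfl, huj]
    ext i
    simp only [PiLp.sub_apply, PiLp.add_apply, PiLp.smul_apply, smul_eq_mul]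
    field_simp
    ring
  have h21 : ∀ y, R₂ (R₁ y) = y := fun y => by
    simp only [hR₁, hR₂, _root_.add_apply, ContinuousLinearMap.id_apply, _root_.sub_apply,
      _root_.smul_apply, ContinuousLinearMap.smulRight_apply, map_add, map_smul]
    simp only [show ∀ z : 𝔼 4, (π₄ j) z = z j from fun z => rfl, huj]
    ext i
    simp only [PiLp.sub_apply, PiLp.add_apply, PiLp.smul_apply, smul_eq_mul]
    field_simp
    ring
  set R : 𝔼 4 ≃L[ℝ] 𝔼 4 := ContinuousLinearEquiv.equivOfInverse R₁ R₂ h21 h12 with hR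
  have hRa : ∀ y, R y = y + y j • u := fun y => by
    show R₁ y = _
    simp [hR₁]
  have hRej : R ej = k₀ := by
    rw [hRa]
    simp [hej, hu]
  have hR0 : ∀ y, R y 0 = y 0 := fun y => by
    rw [hRa]
    have hu0 : u 0 = 0 := by simp [hu, hej, hk₀0, hj0.symm]
    simp [hu0]
  -- the transposition of the coordinates `1` and `j`
  set Pj : 𝔼 4 ≃L[ℝ] 𝔼 4 :=
    (LinearIsometryEquiv.piLpCongrLeft 2 ℝ ℝ (Equiv.swap (1 : Fin 4) j)).toContinuousLinearEquiv
    with hPj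
  have hswap0 : Equiv.swap (1 : Fin 4) j 0 = 0 :=
    Equiv.swap_apply_of_ne_of_ne (by decide) hj0.symm
  have hPj0 : ∀ y, Pj y 0 = y 0 := fun y => by
    simp [hPj, Equiv.piCongrLeft'_apply, hswap0]
  have hPjej : Pj ej = EuclideanSpace.single (1 : Fin 4) (1 : ℝ) := by
    rw [hej]
    ext i
    simp [hPj]
  refine ⟨R.symm.trans Pj, fun y => ?_, ?_⟩
  · rw [ContinuousLinearEquiv.trans_apply, hPj0]
    have := hR0 (R.symm y)
    rw [ContinuousLinearEquiv.apply_symm_apply] at this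
    exact this.symm
  · rw [ContinuousLinearEquiv.trans_apply, ← hRej, ContinuousLinearEquiv.symm_apply_apply, hPjej]

/-- A source reparametrisation by a linear automorphism preserving `y₀` keeps the rank-one
form: `rankOneMap f ∘ T⁻¹ = rankOneMap (f ∘ T⁻¹)`. [folklore] -/
theorem rankOneMap_comp_symm {f : 𝔼 4 → ℝ} {T : 𝔼 4 ≃L[ℝ] 𝔼 4} (hT : ∀ y : 𝔼 4, T y 0 = y 0) :
    OneJet.rankOneMap f ∘ T.symm = OneJet.rankOneMap (f ∘ T.symm) := by
  funext y
  have h := hT (T.symm y)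
  rw [ContinuousLinearEquiv.apply_symm_apply] at h
  simp only [Function.comp_apply, OneJet.rankOneMap_apply, h]

/-! ### The synthesis -/

/-- `2 ≤ ∞` in `WithTop ℕ∞`. [folklore] -/
private theorem two_le_infty₄ : (2 : WithTop ℕ∞) ≤ ∞ := WithTop.coe_le_coe.2 le_top

/-- Fibre vectors of the splitting have vanishing first two coordinates. [folklore] -/
theorem split4_symm_inr_apply_one (a : 𝔼 2) : split4.symm (((0 : ℝ), (0 : ℝ)), a) 1 = 0 := by
  rw [split4_symm_apply]
  simp

/-- A fibre vector of `ℝ⁴` is a multiple of `e₁` plus a vector of the splitting fibre.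
[folklore] -/
theorem exists_eq_smul_single_one_add (w : 𝔼 4) (hw : w 0 = 0) :
    ∃ b : 𝔼 2, w = (w 1) • EuclideanSpace.single (1 : Fin 4) (1 : ℝ) +
      split4.symm (((0 : ℝ), (0 : ℝ)), b) := by
  refine ⟨WithLp.toLp 2 ![w 2, w 3], ?_⟩
  rw [split4_symm_apply]
  ext i
  fin_cases i <;> simp [hw]

/-- **Every transverse cusp candidate has a cusp-splitting chart.**  Let `F : ℝ⁴ → ℝ²` be
`C^∞` with `dF_p ≠ 0`, `p` a cusp candidate of `F` at which `j¹F ⋔ S₁`.  Then in centred smooth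
charts at `p` and `F p`, `F = (t, h(t, x) + ε₂ y² + ε₃ z²)` with `h` `C^∞`, `h 0 = 0`,
`ε₂, ε₃ = ±1` (`HasCuspSplitChart F p`) — the reduction of the cusp of a generic map of a
4-manifold to Whitney's planar form (Golubitsky–Guillemin VI §2, (†)).
[cite: GolubitskyGuillemin1973, Ch. VI §2, (2.1), (†) p. 147] [cite: BaykurSaeki2017, §2.1, p. 6] -/
theorem hasCuspSplitChart_of_isCuspCandidateAt {F : 𝔼 4 → 𝔼 2} (hF : ContDiff ℝ ∞ F) {p : 𝔼 4}
    (hp : fderiv ℝ F p ≠ 0) (hcc : OneJet.IsCuspCandidateAt F p)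
    (htr : OneJet.IsOneJetTransverseAt F p) : HasCuspSplitChart F p := by
  -- Step 1: rank-one charts
  obtain ⟨φ, ψ, f, hpφ, hp0, hmaps, hφ, hφs, hψ, hψs, hf, hid⟩ := exists_rankOne_charts hF hp
  have h0t : (0 : 𝔼 4) ∈ φ.target := hp0 ▸ φ.map_source hpφ
  -- Step 2: cut `f` off outside `φ.target`
  obtain ⟨χ, hχ, hχt, hχ1⟩ :=
    Literature.Analysis.Calculus.exists_contDiff_bump_nhds φ.open_target h0t
  set fc : 𝔼 4 → ℝ := fun y => χ y * f y with hfc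
  have hfcs : ContDiff ℝ ∞ fc := by
    rw [contDiff_iff_contDiffAt]
    intro y
    by_cases hy : y ∈ φ.target
    · exact hχ.contDiffAt.mul (hf.contDiffAt (φ.open_target.mem_nhds hy))
    · have hy' : y ∉ tsupport χ := fun h => hy (hχt h)
      have hev : fc =ᶠ[𝓝 y] fun _ => 0 := by
        filter_upwards [(isClosed_tsupport χ).isOpen_compl.mem_nhds hy'] with z hz
        show χ z * f z = 0
        rw [image_eq_zero_of_notMem_tsupport hz, zero_mul]
      exact (contDiffAt_const (c := (0 : ℝ))).congr_of_eventuallyEq hev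
  -- the local representative equals the rank-one map of `fc` near `0 = φ p`
  have hrep : OneJet.rankOneMap fc =ᶠ[𝓝 (0 : 𝔼 4)] (ψ ∘ F ∘ φ.symm) := by
    filter_upwards [φ.open_target.mem_nhds h0t, hχ1] with y hy hχy
    have hq : φ.symm y ∈ φ.source := φ.map_target hy
    obtain ⟨h0', h1'⟩ := hid (φ.symm y) hq
    rw [φ.right_inv hy] at h0' h1'
    ext i
    fin_cases i
    · show OneJet.rankOneMap fc y 0 = ψ (F (φ.symm y)) 0
      rw [OneJet.rankOneMap_apply_zero, h0']
    · show OneJet.rankOneMap fc y 1 = ψ (F (φ.symm y)) 1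
      rw [OneJet.rankOneMap_apply_one, h1']
      show χ y * f y = f y
      rw [hχy, one_mul]
  -- Step 3: transport the two conditions to `rankOneMap fc` at `0`
  obtain ⟨A, -, hA⟩ := exists_fderiv_continuousLinearEquiv φ hφ hφs (by simp) hpφ
  rw [hp0] at hA
  have hpψ : F p ∈ ψ.source := hmaps hpφ
  obtain ⟨B, hB, -⟩ := exists_fderiv_continuousLinearEquiv ψ hψ hψs (by simp) hpψ
  have hφs2 : ContDiffAt ℝ 2 φ.symm 0 :=
    ((hφs.contDiffAt (φ.open_target.mem_nhds h0t)).of_le two_le_infty₄)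
  have hψ2 : ContDiffAt ℝ 2 ψ (F p) := (hψ.contDiffAt (ψ.open_source.mem_nhds hpψ)).of_le two_le_infty₄
  have hF2 : ContDiffAt ℝ 2 F p := hF.contDiffAt.of_le two_le_infty₄
  have hp' : φ.symm 0 = p := by rw [← hp0, φ.left_inv hpφ]
  have hψF2 : ContDiffAt ℝ 2 (ψ ∘ F) (φ.symm 0) := by
    rw [hp']
    exact hψ2.comp p hF2
  have hcc' : OneJet.IsCuspCandidateAt (OneJet.rankOneMap fc) 0 := by
    rw [OneJet.isCuspCandidateAt_congr_of_eventuallyEq hrep,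
      show ψ ∘ F ∘ φ.symm = (ψ ∘ F) ∘ φ.symm from rfl,
      OneJet.isCuspCandidateAt_comp_iff A.symm hA hφs2 hψF2, hp',
      OneJet.isCuspCandidateAt_comp_target_iff B hB hψ2 hF2]
    exact hcc
  have htr' : OneJet.IsOneJetTransverseAt (OneJet.rankOneMap fc) 0 := by
    rw [OneJet.isOneJetTransverseAt_congr_of_eventuallyEq hrep,
      show ψ ∘ F ∘ φ.symm = (ψ ∘ F) ∘ φ.symm from rfl,
      OneJet.isOneJetTransverseAt_comp_iff A.symm hA hφs2 hψF2, hp',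
      OneJet.isOneJetTransverseAt_comp_target_iff B hB hψ2 hF2]
    exact htr
  -- Step 4: read the conditions on `fc`
  have hfcΩ : ContDiffOn ℝ ∞ fc univ := hfcs.contDiffOn
  obtain ⟨hcrit, k₀, hk₀0, hk₀, hrad⟩ :=
    (OneJet.isCuspCandidateAt_rankOneMap_iff isOpen_univ hfcΩ (mem_univ 0)).1 hcc'
  have htrk := (OneJet.isOneJetTransverseAt_rankOneMap_iff isOpen_univ hfcΩ (mem_univ 0) hcrit).1
    htr'
  have hsymm : ∀ v w, fderiv ℝ (fderiv ℝ fc) 0 v w = fderiv ℝ (fderiv ℝ fc) 0 w v := fun v w =>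
    (hfcs.contDiffAt.isSymmSndFDerivAt
      (by simp only [minSmoothness_of_isRCLikeNormedField]; exact two_le_infty₄)) v w
  -- a radical vector `r` of the fibre Hessian has `D²fc(v, r) = v₀ D²fc(e₀, r)`
  set e0 : 𝔼 4 := EuclideanSpace.single (0 : Fin 4) (1 : ℝ) with he0
  have hradial : ∀ r : 𝔼 4, (∀ k : 𝔼 4, k 0 = 0 → fderiv ℝ (fderiv ℝ fc) 0 k r = 0) →
      ∀ v : 𝔼 4, fderiv ℝ (fderiv ℝ fc) 0 v r = v 0 * fderiv ℝ (fderiv ℝ fc) 0 e0 r := by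
    intro r hr v
    obtain ⟨v', hv', hv⟩ := OneJet.eq_smul_single_add v
    conv_lhs => rw [hv]
    rw [map_add, map_smul, _root_.add_apply, _root_.smul_apply, hr v' hv', add_zero, smul_eq_mul]
  -- `α = D²fc(e₀, k₀) ≠ 0` by transversality
  have hα : fderiv ℝ (fderiv ℝ fc) 0 e0 k₀ ≠ 0 := by
    intro hα
    refine hk₀0 (htrk k₀ hk₀ fun v => ?_)
    rw [hradial k₀ hrad v, hα, mul_zero]
  -- Step 5: the shear putting `k₀` on the `y₁`-axis
  obtain ⟨T, hT0, hTk₀⟩ := exists_shear hk₀0 hk₀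
  have hTs0 : ∀ y : 𝔼 4, T.symm y 0 = y 0 := fun y => by
    have := hT0 (T.symm y)
    rw [ContinuousLinearEquiv.apply_symm_apply] at this
    exact this.symm
  have hTe₁ : T.symm (EuclideanSpace.single (1 : Fin 4) (1 : ℝ)) = k₀ := by
    rw [← hTk₀, ContinuousLinearEquiv.symm_apply_apply]
  set f₂ : 𝔼 4 → ℝ := fc ∘ T.symm with hf₂_def
  have hf₂ : ContDiff ℝ ∞ f₂ := hfcs.comp T.symm.contDiff
  have hd1 : ∀ v, fderiv ℝ f₂ 0 v = fderiv ℝ fc 0 (T.symm v) := fun v => by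
    rw [hf₂_def, T.symm.comp_right_fderiv]
    simp
  have hd2 : ∀ v w, fderiv ℝ (fderiv ℝ f₂) 0 v w =
      fderiv ℝ (fderiv ℝ fc) 0 (T.symm v) (T.symm w) := by
    intro v w
    have hτ2 : ContDiffAt ℝ 2 (T.symm : 𝔼 4 → 𝔼 4) 0 := T.symm.contDiff.contDiffAt.of_le two_le_infty₄
    have hfc2 : ContDiffAt ℝ 2 fc (T.symm 0) := hfcs.contDiffAt.of_le two_le_infty₄
    rw [hf₂_def, fderiv_fderiv_comp_apply_eq_add hfc2 hτ2 v w]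
    have h0 : fderiv ℝ (fderiv ℝ (T.symm : 𝔼 4 → 𝔼 4)) 0 v w = 0 := by
      have : fderiv ℝ (T.symm : 𝔼 4 → 𝔼 4) = fun _ => (T.symm : 𝔼 4 →L[ℝ] 𝔼 4) := by
        funext q'
        exact T.symm.fderiv
      rw [this]
      simp
    rw [h0, map_zero, zero_add, T.symm.fderiv, map_zero]
    rfl
  have hcrit₂ : ∀ v : 𝔼 4, v 0 = 0 → fderiv ℝ f₂ 0 v = 0 := fun v hv => by
    rw [hd1]
    exact hcrit _ (by rw [hTs0]; exact hv)
  -- Step 6: the `(y₂, y₃)`-block of `D²f₂(0)` is nondegenerate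
  have hnd₂ : ∀ a : 𝔼 2, (∀ b : 𝔼 2,
      fderiv ℝ (fderiv ℝ f₂) 0 (split4.symm (((0 : ℝ), (0 : ℝ)), a))
        (split4.symm (((0 : ℝ), (0 : ℝ)), b)) = 0) → a = 0 := by
    intro a ha
    set wa : 𝔼 4 := split4.symm (((0 : ℝ), (0 : ℝ)), a) with hwa
    set k : 𝔼 4 := T.symm wa with hk
    have hk0 : k 0 = 0 := by rw [hk, hTs0, hwa, split4_symm_inr_apply_zero]
    -- `k` is a radical vector of the fibre Hessian of `fc`
    have hkrad : ∀ w : 𝔼 4, w 0 = 0 → fderiv ℝ (fderiv ℝ fc) 0 w k = 0 := by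
      intro w hw
      set w' : 𝔼 4 := T w with hw'
      have hw'0 : w' 0 = 0 := by rw [hw', hT0]; exact hw
      obtain ⟨b, hb⟩ := exists_eq_smul_single_one_add w' hw'0
      have hww : w = T.symm w' := by rw [hw', ContinuousLinearEquiv.symm_apply_apply]
      rw [hww, hk, ← hd2, hb, map_add, map_smul, _root_.add_apply, _root_.smul_apply]
      have h1 : fderiv ℝ (fderiv ℝ f₂) 0 (EuclideanSpace.single (1 : Fin 4) (1 : ℝ)) wa = 0 := by
        rw [hd2, hTe₁, ← hk, hsymm]
        exact hrad k hk0
      have h2 : fderiv ℝ (fderiv ℝ f₂) 0 (split4.symm (((0 : ℝ), (0 : ℝ)), b)) wa = 0 := by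
        rw [hd2, hsymm, ← hd2]
        exact ha b
      rw [h1, h2, smul_zero, add_zero]
    -- by transversality the radical is the line `ℝ k₀`
    set α : ℝ := fderiv ℝ (fderiv ℝ fc) 0 e0 k₀ with hαdef
    set β : ℝ := fderiv ℝ (fderiv ℝ fc) 0 e0 k with hβdef
    set r : 𝔼 4 := α • k - β • k₀ with hr
    have hr0 : r 0 = 0 := by simp [hr, hk0, hk₀]
    have hrrad : ∀ w : 𝔼 4, w 0 = 0 → fderiv ℝ (fderiv ℝ fc) 0 w r = 0 := fun w hw => by
      rw [hr, map_sub, map_smul, map_smul, hkrad w hw, hrad w hw, smul_zero, smul_zero, sub_zero]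
    have hre0 : fderiv ℝ (fderiv ℝ fc) 0 e0 r = 0 := by
      rw [hr, map_sub, map_smul, map_smul, smul_eq_mul, smul_eq_mul, ← hαdef, ← hβdef]
      ring
    have hrz : r = 0 := htrk r hr0 fun v => by rw [hradial r hrrad v, hre0, mul_zero]
    have hkk₀ : k = (β / α) • k₀ := by
      have h : α • k = β • k₀ := sub_eq_zero.1 (by rw [← hr]; exact hrz)
      rw [div_eq_mul_inv, mul_comm, mul_smul, ← h, smul_smul, inv_mul_cancel₀ hα, one_smul]
    -- hence `wa = T k` is a multiple of `e₁`; its first coordinate vanishes, so `wa = 0`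
    have hwa' : wa = (β / α) • EuclideanSpace.single (1 : Fin 4) (1 : ℝ) := by
      have : wa = T k := by rw [hk, ContinuousLinearEquiv.apply_symm_apply]
      rw [this, hkk₀, map_smul, hTk₀]
    have hq : β / α = 0 := by
      have h1 := congrArg (fun z : 𝔼 4 => z 1) hwa'
      simp only [hwa, split4_symm_inr_apply_one, PiLp.smul_apply, smul_eq_mul] at h1
      simpa using h1.symm
    have hwa0 : wa = 0 := by rw [hwa', hq, zero_smul]
    have := congrArg split4 hwa0
    rw [hwa, ContinuousLinearEquiv.apply_symm_apply, map_zero] at this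
    simpa using congrArg Prod.snd this
  -- Step 7: the chart of the rank-one map of `f₂`, transported back
  have h₂ : HasCuspSplitChart (OneJet.rankOneMap f₂) 0 :=
    hasCuspSplitChart_rankOneMap hf₂ hcrit₂ hnd₂
  have h₁ : HasCuspSplitChart (OneJet.rankOneMap fc) 0 := by
    refine HasCuspSplitChart.of_comp_continuousLinearEquiv T ?_
    rw [map_zero, rankOneMap_comp_symm hT0]
    exact h₂
  have h₀ : HasCuspSplitChart (ψ ∘ F ∘ φ.symm) (φ p) := by
    rw [hp0]
    exact h₁.congr_of_eventuallyEq hrep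
  exact HasCuspSplitChart.of_localRepresentative hφ hφs hψ hψs hmaps hpφ h₀

end Literature.Topology.FourManifolds
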